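import Summits.BirchSwinnertonDyer.BirchSwinnertonDyer.Theorems.KolyvaginRoadThreeMethod2LocalInputsLineTrans
import HarnessLib

/-!
# Route `KolyvaginRoadThree`, deciding crux `ZhangSharpFrameAtThreeHL` (item stmt-BirchSwinnertonDyer-19574):
# the input (Equiv) of stub A `stub_levelRaisingAtThree` — complex conjugation acts on `H¹(K_q, E[3])` by a scalar
# sign (W. Zhang 2014 (9.2)) — REDUCED IN THE KERNEL to the tame sign law at the good unipotent-admissible prime
# (cell `bsd-stepL`, seat `bsd-stepL-zhang3-p1` g7; `--supports stmt-BirchSwinnertonDyer-19574`, helper)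

WHY THIS FILE. Of koly3a's five inputs of stub A (`Method2.selQ_rankLowering_on_of_localGlobal`, p464695), (Line) and
(Trans) are kernel theorems (`KolyvaginRoadThreeMethod2LocalInputsLineTrans`, zhang3-p1 g7). (Equiv) asks, at a good
unipotent-admissible `q` (inert in `K`, `q ≡ 1 (mod 3)`, `Frob_q² ≠ 1` on `E[3]`) and the place `v ∣ q`, for a sign
`s` with `loc_v (c_* z) = sgn s · loc_v z` for EVERY `z ∈ H¹(K, E[3])`, `c` the complex conjugation of `K` acting on
`H¹(K, E[3])` through a lift (`conjAct`). This file proves (Equiv) for `[K : ℚ] = 2` from ONE local Galois-theoretic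
input, the TAME SIGN LAW (TS) at `v`: for the lift `t = e h e⁻¹` of `c` transported from an arithmetic Frobenius
`h ∈ Γ_ℚ` above `q` and `F ∈ Γ_K` with `res F = h²`, every continuous cocycle `φ : Γ_K → E(K̄)[3]` satisfies
`φ(t⁻¹ i t) = φ(i) = φ(F i F⁻¹)` on the inertia group `I_𝔓` (on which `φ` is a homomorphism into a group of exponent
`3`; conjugation by a Frobenius acts on tame inertia by `u ↦ u^q`, Serre 1972 §1.8, and `q ≡ q² ≡ 1 (mod 3)` — the tree
has this for LOCAL fields, `InertiaHomFrobeniusTwist`, `FrobeniusOnTameInertiaImage`; the number-field form at `𝔓` is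
the remaining plumbing). Contents: §1 a finite check over `M₂(𝔽₃)` (a determinant-one `H` with `H² ≠ 1` acts by ONE
sign `δ` both on `𝔽₃²/(H² − 1)` and on `ker(H² − 1)`); §2 its form on `E(ℚ̄)[3]` for `h` with `χ̄₃(h) = 1`; §3 the lift
`t` of `c` at `v ∣ q` (`t|_K = c` because `f(v|q) = 2` forbids `h ∈ res Γ_K`), `t² = F` the Frobenius of the local
picture, and the sign `ε` of `t` on `E(K̄)[3]`; §4 (Equiv) VERBATIM from (TS): the cocycle `t φ(t⁻¹ · t) − ε φ − ∂P`
vanishes at `F`, on `I_𝔓` (by (TS) and `φ(I_𝔓) ⊆ E[3]^F`) and on an open subgroup, hence on `G_𝔓`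
(`LocalFrob.cocycle_apply_eq_zero_of_mem_decompositionSubgroup`).
HONEST FRAMING: theorems only; no definition, no named fact, no `sorry`; (Equiv) is NOT proved outright — it is reduced to
(TS); (Cheb), (Iso), stub B untouched; nothing is booked. PARTITION: O2@3 (B10) × A1 × crux 19574 × stub A — none (T7).

References: [cite: WZhang2014, §9 (9.2), Notations (xii)] [cite: BertoliniDarmon2005, §2.2 Lemma 2.6]
[cite: SerreInventiones1972, §1.8 Prop. 6] [cite: GrossLMS1991, §5 (5.1), §9 Prop. 9.6] [cite: NeukirchANT1999, Ch. I §9].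
-/

noncomputable section

open scoped Pointwise
open WeierstrassCurve NumberField IsDedekindDomain Field Rat.HeightOneSpectrum
open Literature.NumberTheory.EllipticCurves Literature.NumberTheory.GaloisRepresentations Module

namespace Summit.BirchSwinnertonDyer.Rank1Residual.X11b.Three.Koly.Method2.LocalFrob

/-! ## §1 One sign on the quotient and on the fixed line -/

set_option maxRecDepth 16384 in
/-- For `H ∈ SL₂(𝔽₃)` with `H² ≠ 1` there is ONE sign `δ = ±1` with `H ≡ δ` on `𝔽₃²/(H² − 1)𝔽₃²` and `H = δ` on
`ker(H² − 1)` (`H² = −1`: both conditions empty; `H²` unipotent: `H = δ(1 + N)`). Finite check. [folklore] -/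
theorem sign_dichotomy_of_det_eq_one :
    ∀ H : Matrix (Fin 2) (Fin 2) (ZMod 3), H.det = 1 → H * H ≠ 1 →
      ((∀ y, ∃ m, H.mulVec y - y = (H * H - 1).mulVec m) ∧ ∀ y, (H * H).mulVec y = y → H.mulVec y = y) ∨
      ((∀ y, ∃ m, H.mulVec y + y = (H * H - 1).mulVec m) ∧ ∀ y, (H * H).mulVec y = y → H.mulVec y = -y) := by
  decide

/-! ## §2 The sign of `h` on `E(ℚ̄)[3]` -/

section Rational

variable (W : WeierstrassCurve ℚ) [W.IsElliptic]

/-- **The sign of `h` modulo `(h² − 1)E[3]` and on `E[3]^{h²}`.** For `h ∈ Γ_ℚ` with `χ̄₃(h) = 1` and `h² ≠ 1` on `E[3]`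
there is `ε = ±1` with `h y − ε y ∈ (h² − 1)E[3]` for all `y` and `h y = ε y` for all `h²`-fixed `y` (frame
`E[3] ≃ 𝔽₃²`, `det = χ̄₃ = 1` by the Weil pairing, and §1). [cite: SilvermanCSS1997, Ch. II §7–§8] -/
theorem exists_sign_of_cyclotomic_eq_one {h : absoluteGaloisGroup ℚ} (hχ : modPCyclotomicCharacterZMod ℚ 3 h = 1)
    (hne : ∃ P : geomTorsion W ((3 ^ 1 : ℕ) : ℤ), h • h • P ≠ P) :
    ∃ ε : ℤ, (ε = 1 ∨ ε = -1) ∧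
      (∀ y : geomTorsion W ((3 ^ 1 : ℕ) : ℤ), ∃ m : geomTorsion W ((3 ^ 1 : ℕ) : ℤ), h • y - ε • y = h • h • m - m) ∧
      ∀ y : geomTorsion W ((3 ^ 1 : ℕ) : ℤ), h • h • y = y → h • y = ε • y := by
  have hT : ∀ P : geomTorsion W ((3 ^ 1 : ℕ) : ℤ), 3 • P = 0 := fun P ↦ by
    have := (mem_geomTorsion_iff W _ _).mp P.2
    apply Subtype.ext
    rw [AddSubgroupClass.coe_nsmul, ← natCast_zsmul]
    exact this
  have hcard : Nat.card (geomTorsion W ((3 ^ 1 : ℕ) : ℤ)) = 3 ^ 2 :=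
    card_torsionPoints_eq_sq_holds W (AlgebraicClosure ℚ) (n := 3 ^ 1) (by norm_num)
  obtain ⟨eT⟩ := KolyvaginImage.nonempty_addEquiv_of_card_eq_sq (p := 3) hT hcard
  set f : (Fin 2 → ZMod 3) →+ (Fin 2 → ZMod 3) :=
    (eT.toAddMonoidHom.comp (DistribSMul.toAddMonoidHom (geomTorsion W ((3 ^ 1 : ℕ) : ℤ)) h)).comp
      eT.symm.toAddMonoidHom with hf
  set H : Matrix (Fin 2) (Fin 2) (ZMod 3) := LinearMap.toMatrix' (f.toZModLinearMap 3) with hH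
  have hHP : ∀ P : geomTorsion W ((3 ^ 1 : ℕ) : ℤ), eT (h • P) = H.mulVec (eT P) := fun P ↦ by
    rw [hH, LinearMap.toMatrix'_mulVec, AddMonoidHom.coe_toZModLinearMap, hf]; simp
  have hdet : H.det = 1 := by
    rw [det_eq_modPCyclotomicCharacterZMod_of_exists_weilPairing W 3 (exists_weilPairing_holds W 3) eT h H hHP, hχ,
      Units.val_one]
  have hH2 : ∀ P : geomTorsion W ((3 ^ 1 : ℕ) : ℤ), eT (h • h • P) = (H * H).mulVec (eT P) := fun P ↦ by
    rw [hHP, hHP, Matrix.mulVec_mulVec]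
  have hsq : H * H ≠ 1 := by
    obtain ⟨P, hP⟩ := hne
    exact fun h1 ↦ hP (eT.injective (by rw [hH2, h1, Matrix.one_mulVec]))
  have hsub : ∀ m : geomTorsion W ((3 ^ 1 : ℕ) : ℤ), eT (h • h • m - m) = (H * H - 1).mulVec (eT m) := fun m ↦ by
    rw [map_sub, hH2, Matrix.sub_mulVec, Matrix.one_mulVec]
  rcases sign_dichotomy_of_det_eq_one H hdet hsq with ⟨hquot, hker⟩ | ⟨hquot, hker⟩
  · refine ⟨1, Or.inl rfl, fun y ↦ ?_, fun y hy ↦ ?_⟩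
    · obtain ⟨m', hm'⟩ := hquot (eT y)
      refine ⟨eT.symm m', eT.injective ?_⟩
      rw [map_sub, hHP, one_zsmul, hsub, eT.apply_symm_apply, hm']
    · apply eT.injective
      rw [hHP, one_zsmul]
      exact hker _ (by rw [← hH2, hy])
  · refine ⟨-1, Or.inr rfl, fun y ↦ ?_, fun y hy ↦ ?_⟩
    · obtain ⟨m', hm'⟩ := hquot (eT y)
      refine ⟨eT.symm m', eT.injective ?_⟩
      rw [map_sub, hHP, neg_one_zsmul, map_neg, sub_neg_eq_add, hsub, eT.apply_symm_apply, ← hm']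
    · apply eT.injective
      rw [hHP, neg_one_zsmul, map_neg]
      exact hker _ (by rw [← hH2, hy])

end Rational

/-! ## §3 The lift of complex conjugation at a place above a good unipotent-admissible prime -/

section Lift

variable (W : WeierstrassCurve ℚ) [W.IsElliptic] [W.IsGloballyMinimal] (K : Type) [Field K] [NumberField K]

/-- **The Frobenius lift of complex conjugation at `v ∣ q`** (`q` good unipotent-admissible, `[K : ℚ] = 2`, `c ≠ 1`).
There are an arithmetic Frobenius `h ∈ Γ_ℚ` at the prime of `\bar ℤ` below `𝔓 = 𝔓_{ι₀,𝔐}`, an arithmetic Frobenius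
`F ∈ Γ_K` at `𝔓` with `res F = h²`, and a sign `ε = ±1`, such that the transport `t = e h e⁻¹` LIFTS `c` (`h ∉ res Γ_K`
since `f(v|q) = 2`), `t⁻¹ F t = F`, and `t` acts on `E(K̄)[3]` (`IsLiftOfAut.torsionMap`) as `ε` modulo `(F − 1)E(K̄)[3]`
and as `ε` on `E(K̄)[3]^F` (§2 transported along `E(ℚ̄)[3] ≃ E(K̄)[3]`; `χ̄₃(h) = 1` as `q ≡ 1 (mod 3)`). This is the
`p = 3`, unipotent-admissible analogue of the tree's `exists_frobeniusLift_of_isKolyvaginPrime` (Gross §8).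
[cite: WZhang2014, §9 (9.2)] [cite: GrossLMS1991, §8 (proof of Prop. 8.1)] -/
theorem exists_lift_frob_of_uAdmissible (hK2 : Module.finrank ℚ K = 2) {c : K ≃ₐ[ℚ] K} (hc1 : c ≠ 1) {q : ℕ}
    (hq : IsUAdmissiblePrime W K q) (hgoodq : FrobSqNeOneAt W 3 q) (v : HeightOneSpectrum (𝓞 K))
    (hqv : (q : 𝓞 K) ∈ v.asIdeal) {𝔐 : Ideal (HeightOneSpectrum.localAbsIntegers v)} (h𝔐 : 𝔐 ∈ v.localPrimesAbove) :
    ∃ (h : absoluteGaloisGroup ℚ) (F : absoluteGaloisGroup K)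
      (ht : IsLiftOfAut c (absGaloisTransport (K := ℚ) (L := K) h).toRingEquiv) (ε : ℤ),
      IsArithFrobAt (𝓞 ℚ) h ((v.primeBelow (closureEmb (K := K) (v.adicCompletion K)) 𝔐).comap (absIntegersMap ℚ K)) ∧
      IsArithFrobAt (𝓞 K) F (v.primeBelow (closureEmb (K := K) (v.adicCompletion K)) 𝔐) ∧
      absGaloisRestrict ℚ K F = h ^ 2 ∧ ht.conjGalCMH F = F ∧ (ε = 1 ∨ ε = -1) ∧
      (∀ y : geomTorsion (W.baseChange K) ((3 ^ 1 : ℕ) : ℤ), ∃ m : geomTorsion (W.baseChange K) ((3 ^ 1 : ℕ) : ℤ),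
        ht.torsionMap W ((3 ^ 1 : ℕ) : ℤ) y - ε • y = F • m - m) ∧
      ∀ y : geomTorsion (W.baseChange K) ((3 ^ 1 : ℕ) : ℤ), F • y = y → ht.torsionMap W ((3 ^ 1 : ℕ) : ℤ) y = ε • y := by
  haveI : Algebra.IsQuadraticExtension ℚ K := ⟨hK2⟩
  have hq' := hq
  obtain ⟨hqprime, -, -, -, hinert, hq3, -⟩ := hq
  set ι₀ := closureEmb (K := K) (v.adicCompletion K) with hι₀
  set 𝔓 := v.primeBelow ι₀ 𝔐 with h𝔓def
  have h𝔓 : 𝔓 ∈ v.primesAbove := HeightOneSpectrum.primeBelow_mem_primesAbove h𝔐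
  set w : HeightOneSpectrum (𝓞 ℚ) := v.under (𝓞 ℚ) with hw
  have hwv : v.asIdeal.under (𝓞 ℚ) = w.asIdeal := rfl
  have hqw : (q : 𝓞 ℚ) ∈ w.asIdeal := by
    rw [← hwv, Ideal.under_def, Ideal.mem_comap, map_natCast]; exact hqv
  set 𝔓' := 𝔓.comap (absIntegersMap ℚ K) with h𝔓'def
  have h𝔓' : 𝔓' ∈ w.primesAbove := comap_absIntegersMap_mem_primesAbove hwv h𝔓
  -- the `FrobSqNeOneAt` Frobenius, moved to `𝔓'`
  obtain ⟨v₀, 𝔓₁, h₁, hqv₀, h𝔓₁, hFrob₁, P₁, hP₁⟩ := hgoodq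
  have hv₀ : v₀ = w := HeightOneSpectrum.eq_of_natCast_mem_rat hqprime hqv₀ hqw
  subst hv₀
  obtain ⟨γ, -, hFrob⟩ := HeightOneSpectrum.exists_isArithFrobAt_conj_of_mem_primesAbove_holds h𝔓₁ h𝔓' hFrob₁
  set h := γ * h₁ * γ⁻¹ with hh
  have hne : ∃ P : geomTorsion W ((3 ^ 1 : ℕ) : ℤ), h • h • P ≠ P := by
    refine ⟨γ • P₁, fun heq ↦ hP₁ (smul_left_cancel γ ?_)⟩
    have hconj : h • h • γ • P₁ = γ • h₁ • h₁ • P₁ := by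
      rw [hh, ← mul_smul, ← mul_smul, ← mul_smul, ← mul_smul]
      congr 1
      group
    rw [← hconj, heq]
  have hχ := modPCyclotomicCharacterZMod_three_eq_one_of_isArithFrobAt hqprime hq3 hqw h𝔓' hFrob
  obtain ⟨ε, hε, hquot, hker⟩ := exists_sign_of_cyclotomic_eq_one W hχ hne
  -- `F` with `res F = h²`, an arithmetic Frobenius at `𝔓` (`f(v|q) = 2`)
  obtain ⟨F, hF⟩ := sq_mem_range_absGaloisRestrict K hK2 h
  have hf2 := inertiaDeg_eq_two_of_isPrime_span K hK2 hqprime hinert v hqv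
  have hFrobF : IsArithFrobAt (𝓞 K) F 𝔓 :=
    isArithFrobAt_of_absGaloisRestrict_eq_pow (F := ℚ) (M := K) hwv h𝔓 hFrob (by rw [hF, hf2])
  -- the transport `t = e h e⁻¹` lifts `c`
  set tA := absGaloisTransport (K := ℚ) (L := K) h with htA
  have hne1 : tA.restrictNormal K ≠ 1 := by
    intro h1
    have hmem : h ∈ Set.range (absGaloisRestrict ℚ K) := by
      rw [mem_range_absGaloisRestrict_iff]
      intro x
      have hx := AlgEquiv.restrictNormal_commutes tA K x
      rw [h1, AlgEquiv.one_apply] at hx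
      exact hx.symm
    obtain ⟨τ, hτ⟩ := hmem
    have hf1 := inertiaDeg_eq_one_of_isArithFrobAt_absGaloisRestrict (F := ℚ) (M := K) hwv h𝔓 (τ := τ)
      (by rw [hτ]; exact hFrob)
    rw [hf2] at hf1
    exact absurd hf1 (by norm_num)
  have ht : IsLiftOfAut c tA.toRingEquiv := by
    have hcard : Nat.card (K ≃ₐ[ℚ] K) = 2 := by rw [IsGalois.card_aut_eq_finrank, hK2]
    obtain ⟨y, -, hy⟩ := (Nat.card_eq_two_iff' (1 : K ≃ₐ[ℚ] K)).mp hcard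
    rw [hy c hc1, ← hy _ hne1]
    exact RatClosure.isLiftOfAut_restrictNormal_absGaloisTransport h
  -- `t² = F` on `K̄`, hence `t⁻¹ F t = F`
  have hFt : ∀ y : AlgebraicClosure K, F • y = tA (tA y) := fun y ↦ by
    rw [← absGaloisTransport_absGaloisRestrict (K := ℚ) F y, hF, pow_two, map_mul, AlgEquiv.mul_apply]
  have hcF : ht.conjGalCMH F = F := by
    apply AlgEquiv.ext
    intro x
    change tA.toRingEquiv.symm ((show AlgebraicClosure K ≃ₐ[K] AlgebraicClosure K from F)
      (tA.toRingEquiv x)) = (show AlgebraicClosure K ≃ₐ[K] AlgebraicClosure K from F) x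
    rw [RingEquiv.symm_apply_eq]
    change F • tA x = tA (F • x)
    rw [hFt, hFt]
  -- transport of `h`, `h²` along `θ : E(ℚ̄)[3] ≃ E(K̄)[3]`
  set θ := RatClosure.torsionEquiv (K := K) W ((3 ^ 1 : ℕ) : ℤ) with hθ
  have hFθ : ∀ P : geomTorsion W ((3 ^ 1 : ℕ) : ℤ), F • θ P = θ (h • h • P) := fun P ↦ by
    rw [← RatClosure.torsionEquiv_smul, hF, pow_two, mul_smul]
  have htθ : ∀ P : geomTorsion W ((3 ^ 1 : ℕ) : ℤ), ht.torsionMap W ((3 ^ 1 : ℕ) : ℤ) (θ P) = θ (h • P) :=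
    fun P ↦ (RatClosure.torsionEquiv_smul_of_lift W ht h (fun _ ↦ rfl) _ P).symm
  refine ⟨h, F, ht, ε, hFrob, hFrobF, hF, hcF, hε, fun y ↦ ?_, fun y hy ↦ ?_⟩
  · obtain ⟨P, rfl⟩ := θ.surjective y
    obtain ⟨m, hm⟩ := hquot P
    refine ⟨θ m, ?_⟩
    rw [htθ, hFθ, ← map_zsmul, ← map_sub, ← map_sub, hm]
  · obtain ⟨P, rfl⟩ := θ.surjective y
    rw [hFθ] at hy
    rw [htθ, ← map_zsmul, hker P (θ.injective hy)]

end Lift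

end LocalFrob

/-! ## §4 (Equiv) VERBATIM from the tame sign law -/

section Equiv

variable (W : WeierstrassCurve ℚ) [W.IsElliptic] [W.IsGloballyMinimal] (K : Type) [Field K] [NumberField K]

omit [NumberField K] in
/-- Conjugation by an element of the decomposition group preserves the inertia group. [folklore] -/
theorem conj_mem_inertia {𝔓 : Ideal (absIntegers (𝓞 K) K)} {F i : absoluteGaloisGroup K}
    (hF : F ∈ 𝔓.decompositionSubgroup (absoluteGaloisGroup K)) (hi : i ∈ 𝔓.inertia (absoluteGaloisGroup K)) :
    F * i * F⁻¹ ∈ 𝔓.inertia (absoluteGaloisGroup K) := by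
  intro x
  have h1 : F • (i • F⁻¹ • x - F⁻¹ • x) ∈ F • 𝔓 := Ideal.smul_mem_pointwise_smul F _ 𝔓 (hi (F⁻¹ • x))
  rw [Ideal.mem_decompositionSubgroup_iff.mp hF, smul_sub, smul_inv_smul] at h1
  rw [mul_smul, mul_smul]
  exact h1

set_option maxHeartbeats 400000 in
/-- **(Equiv) of `selQ_rankLowering_on_of_localGlobal` from the TAME SIGN LAW, for `[K : ℚ] = 2`.** Hypothesis (TS):
at every place `v ∋ q` of a unipotent-admissible `q`, for every arithmetic Frobenius `h ∈ Γ_ℚ` at the prime of `\bar ℤ`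
below `𝔓_{ι₀,𝔐}` whose transport `t = e h e⁻¹` lifts `c`, and every `F ∈ Γ_K` with `res F = h²`, every continuous
cocycle `φ : Γ_K → E(K̄)[3]` satisfies `φ(t⁻¹ i t) = φ(i) = φ(F i F⁻¹)` for `i ∈ I_𝔓` (Serre 1972 §1.8: conjugation by
a Frobenius raises tame inertia to the `q`-th power; `q ≡ q² ≡ 1 (mod 3)` and `φ|_{I_𝔓}` is a homomorphism into
`E[3]`). Conclusion: (Equiv) VERBATIM — a sign `s` with `loc_v(c_* z) = sgn s · loc_v z` for all `z ∈ H¹(K, E[3])`.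
Proof: with `t, F, ε` of §3 and a cocycle `φ` of `z`, `c_* z` has cocycle `g ↦ t φ(t⁻¹ g t)`; the cocycle
`χ = t φ(t⁻¹ · t) − ε φ − ∂P` (`P` from `t φ(F) − ε φ(F) ∈ (F − 1)E[3]`) vanishes at `F` (`t⁻¹ F t = F`), on `I_𝔓`
((TS), and `φ(I_𝔓) ⊆ E[3]^F` by the cocycle identity `φ(F i F⁻¹) = F φ(i)`) and on an open subgroup, so on `G_𝔓`.
[cite: WZhang2014, §9 (9.2)] [cite: SerreInventiones1972, §1.8 Prop. 6] [cite: GrossLMS1991, §5 (5.1)] -/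
theorem localEquiv_of_tameSign (hK2 : Module.finrank ℚ K = 2) {c : K ≃ₐ[ℚ] K} (hc1 : c ≠ 1)
    (hTS : ∀ (v : HeightOneSpectrum (𝓞 K)) (𝔐 : Ideal (HeightOneSpectrum.localAbsIntegers v)),
      𝔐 ∈ v.localPrimesAbove → ∀ q : ℕ, IsUAdmissiblePrime W K q → (q : 𝓞 K) ∈ v.asIdeal →
      ∀ (h : absoluteGaloisGroup ℚ) (F : absoluteGaloisGroup K),
        IsArithFrobAt (𝓞 ℚ) h ((v.primeBelow (closureEmb (K := K) (v.adicCompletion K)) 𝔐).comap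
          (absIntegersMap ℚ K)) → absGaloisRestrict ℚ K F = h ^ 2 →
      ∀ (ht : IsLiftOfAut c (absGaloisTransport (K := ℚ) (L := K) h).toRingEquiv)
        (φ : contOneCocycles (discreteTopRep (absoluteGaloisGroup K) (geomTorsion (W.baseChange K) ((3 ^ 1 : ℕ) : ℤ)))),
      ∀ i ∈ (v.primeBelow (closureEmb (K := K) (v.adicCompletion K)) 𝔐).inertia (absoluteGaloisGroup K),
        φ.1 (ht.conjGalCMH i) = φ.1 i ∧ φ.1 (F * i * F⁻¹) = φ.1 i) :
    ∀ q : {q // IsUAdmissiblePrime W K q}, FrobSqNeOneAt W 3 q.1 → ∃ s : Bool,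
      ∀ v : HeightOneSpectrum (𝓞 K), ((q : ℕ) : 𝓞 K) ∈ v.asIdeal → ∀ z : V3 W K,
        (W.baseChange K).torsionLocMap (v.adicCompletion K) ((3 ^ 1 : ℕ) : ℤ) (conjAct W c ((3 ^ 1 : ℕ) : ℤ) z) =
          sgn s • (W.baseChange K).torsionLocMap (v.adicCompletion K) ((3 ^ 1 : ℕ) : ℤ) z := by
  intro q hgoodq
  -- the unique place above `q`, a prime of `\bar 𝓞_v` and the lift of §3 there
  have hq0 : (q : ℕ) ≠ 0 := q.2.1.ne_zero
  have hqP : (Ideal.span {((q : ℕ) : 𝓞 K)}).IsPrime := q.2.2.2.2.2.1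
  have hqbot : Ideal.span {((q : ℕ) : 𝓞 K)} ≠ ⊥ := by
    rw [Ne, Ideal.span_singleton_eq_bot]; exact_mod_cast hq0
  set v₀ : HeightOneSpectrum (𝓞 K) := ⟨Ideal.span {((q : ℕ) : 𝓞 K)}, hqP, hqbot⟩ with hv₀
  have hqv₀ : ((q : ℕ) : 𝓞 K) ∈ v₀.asIdeal := Ideal.subset_span rfl
  obtain ⟨𝔐, h𝔐⟩ := v₀.localPrimesAbove_nonempty
  obtain ⟨hgood, h3v⟩ := hasGoodReductionAt_of_uAdmissible W K q.2 v₀ hqv₀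
  obtain ⟨h, F, ht, ε, hFrob, hFrobF, hF, hcF, hε, hquot, hker⟩ :=
    LocalFrob.exists_lift_frob_of_uAdmissible W K hK2 hc1 q.2 hgoodq v₀ hqv₀ h𝔐
  obtain ⟨s, hs⟩ : ∃ s : Bool, sgn s = ε := by
    rcases hε with rfl | rfl
    · exact ⟨true, rfl⟩
    · exact ⟨false, rfl⟩
  refine ⟨s, fun v hqv z ↦ ?_⟩
  have hvv : v = v₀ := placesAbove_eq_of_isPrime_span K hqP hq0 hqv₀ hqv
  subst hvv
  set ι₀ := closureEmb (K := K) (v₀.adicCompletion K) with hι₀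
  set n : ℤ := ((3 ^ 1 : ℕ) : ℤ) with hn
  have h𝔓 := HeightOneSpectrum.primeBelow_mem_primesAbove (ι := ι₀) h𝔐
  haveI := h𝔓.1
  have hI : (v₀.primeBelow ι₀ 𝔐).inertia (absoluteGaloisGroup K) ≤ torsionFixing (W.baseChange K) n :=
    inertia_le_torsionFixing (W.baseChange K) (fun h' ↦ h' hgood) h3v ι₀ h𝔐
  have hFD : F ∈ (v₀.primeBelow ι₀ 𝔐).decompositionSubgroup (absoluteGaloisGroup K) := hFrobF.mem_stabilizer
  obtain ⟨φ, rfl⟩ :=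
    oneCocycleClass_surjective (discreteTopRep (absoluteGaloisGroup K) (geomTorsion (W.baseChange K) n)) z
  -- the cocycle of `c_* z`
  set ψ := contOneCocycles.pullback ht.conjGalCMH
    (resHomOfEquivariant ht.conjGalCMH (ht.torsionMap W n) (ht.torsionMap_smul W n)) φ with hψ
  have hconj : conjAct W c n (oneCocycleClass _ φ) = oneCocycleClass _ ψ := by
    rw [← ht.conjH1_eq_conjAct W n]
    unfold IsLiftOfAut.conjH1
    simp only [LinearMap.toAddMonoidHom_coe, ContinuousLinearMap.coe_coe]
    exact map_oneCocycleClass _ _ _ φ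
  have hψapply : ∀ g, ψ.1 g = ht.torsionMap W n (φ.1 (ht.conjGalCMH g)) := fun g ↦ rfl
  -- `χ = ψ − ε φ`; its class is `c_* z − sgn s • z`; it is locally a coboundary
  have hclass : oneCocycleClass _ (ψ - ε • φ) = oneCocycleClass _ ψ - ε • oneCocycleClass _ φ := by
    rw [oneCocycleClass_sub]
    congr 1
    exact map_zsmul (oneCocycleClassₗ (discreteTopRep (absoluteGaloisGroup K) (geomTorsion (W.baseChange K) n))) ε φ
  suffices hmem : oneCocycleClass _ (ψ - ε • φ) ∈ (W.baseChange K).torsionLocalKer (v₀.adicCompletion K) n by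
    have h0 : (W.baseChange K).torsionLocMap (v₀.adicCompletion K) n (oneCocycleClass _ (ψ - ε • φ)) = 0 := hmem
    rw [hclass, map_sub, map_zsmul, sub_eq_zero, ← hconj] at h0
    rw [h0, hs]
  -- values of `φ` on inertia are `F`-fixed
  have hφI : ∀ i ∈ (v₀.primeBelow ι₀ 𝔐).inertia (absoluteGaloisGroup K), F • φ.1 i = φ.1 i := by
    intro i hi
    have hTSi := (hTS v₀ 𝔐 h𝔐 q q.2 hqv₀ h F hFrob hF ht φ i hi).2
    have hconjI := conj_mem_inertia K hFD hi
    -- cocycle identity: `φ(F i F⁻¹) = φ(F) + F φ(i) + F i φ(F⁻¹)`, `φ(F⁻¹) = −F⁻¹ φ(F)`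
    have h1 := φ.2 (F * i) F⁻¹
    have h2 := φ.2 F i
    have h3 := φ.2 F F⁻¹
    rw [mul_inv_cancel, contOneCocycles.apply_one, discreteTopRep_ρ_apply] at h3
    rw [discreteTopRep_ρ_apply] at h1 h2
    rw [hTSi, h2] at h1
    -- `(F i) • φ(F⁻¹) = F • φ(F⁻¹)` since `F i F⁻¹` fixes `E[3]`
    have h4 : (F * i) • φ.1 F⁻¹ = F • φ.1 F⁻¹ := by
      have := smul_eq_of_mem_torsionFixing (W.baseChange K) n (hI hconjI) (F • φ.1 F⁻¹)
      rw [← mul_smul, mul_assoc, inv_mul_cancel, mul_one] at this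
      exact this
    rw [h4] at h1
    have h5 : F • φ.1 F⁻¹ = -φ.1 F := eq_neg_of_add_eq_zero_right h3.symm
    rw [h5] at h1
    -- `φ i = φ F + F φ i - φ F`
    have h6 : φ.1 F + F • φ.1 i + -φ.1 F = F • φ.1 i := by abel
    exact (h1.trans h6).symm
  -- the coboundary correction at `F`
  obtain ⟨P, hP⟩ := hquot (φ.1 F)
  obtain ⟨χ, hχclass, hχapply⟩ := LocalFrob.exists_cocycle_sub_coboundary (W.baseChange K) (ψ - ε • φ) P
  rw [← hχclass, LocalFrob.oneCocycleClass_mem_torsionLocalKer_iff (W.baseChange K) (n := 3 ^ 1) (by norm_num) h𝔐 χ]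
  refine ⟨0, fun d hd ↦ ?_⟩
  rw [smul_zero, sub_zero]
  obtain ⟨U, hU, hχU⟩ := LocalFrob.exists_isOpen_subgroup_apply_eq_zero (W.baseChange K) (n := n) (by norm_num) χ
  refine LocalFrob.cocycle_apply_eq_zero_of_mem_decompositionSubgroup (W.baseChange K) h𝔓 hFrobF χ ?_ (fun i hi ↦ ?_)
    hU hχU hd
  · -- at `F`: `t φ(t⁻¹ F t) − ε φ(F) − (F P − P) = 0`
    rw [hχapply]
    change ψ.1 F - ε • φ.1 F - (F • P - P) = 0
    rw [hψapply, hcF, ← hP, sub_self]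
  · -- on inertia: `t φ(t⁻¹ i t) − ε φ(i) − (i P − P) = t φ(i) − ε φ(i) = 0`
    rw [hχapply, smul_eq_of_mem_torsionFixing (W.baseChange K) n (hI hi), sub_self, sub_zero]
    change ψ.1 i - ε • φ.1 i = 0
    rw [hψapply, (hTS v₀ 𝔐 h𝔐 q q.2 hqv₀ h F hFrob hF ht φ i hi).1, hker _ (hφI i hi), sub_self]

end Equiv

end Summit.BirchSwinnertonDyer.Rank1Residual.X11b.Three.Koly.Method2

end
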